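import Summits.BirchSwinnertonDyer.BirchSwinnertonDyer.Theorems.UniversalToricDescentRelaxedLayerTransportTorsion
import Literature.NumberTheory.EllipticCurves.LocalEulerCharacteristicTorsion
import Literature.NumberTheory.EllipticCurves.LocalKummerMap
import Summits.BirchSwinnertonDyer.Rank1Residual.X11b.LocalPointsPrimaryComponent
import HarnessLib

/-!
# The local Kummer condition at a place `w ∣ v` of a Galois layer, counted in `Γ_K`-terms:
# `#𝓛_w(E_L[n]) = #E[n]^{U ∩ D_v}` (crux ♭T≤ stmt-BirchSwinnertonDyer-23042, line `sigmacongruence`, stub R1 `stub_relaxedImageCount`, brick (e))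

Route `UniversalToricDescent`, lead prover `bsd-wall-utd-p1` g18. THEOREMS ONLY (no definition, no named fact, no `sorry`);
`--supports stmt-BirchSwinnertonDyer-23042`. BSD is not proved by any of this.

For `K ⊆ L` number fields, `L/K` Galois, `U ≤ galRange L` normal with `res⁻¹ U = Γ_L`, `E = W/K` elliptic, `n ≠ 0` a unit at the finite
place `v` of `K`, and a place `w ∣ v` of `L`:
* §1 `natCard_kummerSelmerStructure_inr_eq_natCard_fixed` — `#𝓛_w = #E_L[n]^{D_w}` (Milne I Lemma 3.3: `#𝓛_w = #E(L_w)[n]·#(𝓞_w/n)`,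
  `#(𝓞_w/n) = 1`, `E(L_w)[n] = H⁰(L_w, E_L[n])`, and `H⁰` = the points fixed by `D_w = range(Γ_{L_w} → Γ_L)`);
* §2 `natCard_fixed_baseChange_eq` — for a local package `(ι, ι₂, closureEmb L_w)`: `#E_L[n]^{D_w} = #E[n]^{U ∩ range(res_ι)}`
  (`E[n] ≃ E_L[n]` and `…TransportTorsion.mem_range_resGalOfEmb_iff_resGal_mem`);
* §3 `natCard_fixed_inf_range_comp_eq` — `#E[n]^{U ∩ τ⁻¹Dτ} = #E[n]^{U ∩ D}` (`a ↦ τ • a`);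
* §4 **`natCard_kummerSelmerStructure_inr_eq`** — `#𝓛_w(E_L[n]) = #{a ∈ E[n] | (U ⊓ D_v)·a = a}` for EVERY `w ∣ v`.
This is input (e) of the relaxed count road: the local factors of the Poitou–Tate pair count over `K_m` at the places over `v` are all
equal to `#E[p^k]^{Γ_m ∩ D_v}`.

References: [MilneADT2006] I Lemma 3.3, I.§6; [GreenbergLNM1716] §2 (decomposition groups of the primes over `η`), §3 (p. 86);
[SerreGaloisCohomology1997] II.§1.1; [NeukirchANT1999] II.§8.
-/

set_option linter.dupNamespace false
set_option autoImplicit false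

noncomputable section
open scoped Classical
open CategoryTheory Field NumberField IsDedekindDomain Function
open Literature.NumberTheory.EllipticCurves Literature.NumberTheory.EllipticCurves.GreenbergSelmer
open Literature.NumberTheory.GaloisRepresentations
open Literature.NumberTheory.GaloisCohomology
open scoped ContRepresentation
open scoped NumberField.LiesOver

namespace Summit.BirchSwinnertonDyer.BirchSwinnertonDyer.Theorems.UniversalToricDescentRelaxedLocalCount

open Summit.BirchSwinnertonDyer.Rank1Residual.X11b.LocBridge
  Summit.BirchSwinnertonDyer.Rank1Residual.Additive Summit.BirchSwinnertonDyer.Rank1Residual.Additive.LocalTransport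
  Summit.BirchSwinnertonDyer.Rank1Residual.Additive.BaseChange
  Summit.BirchSwinnertonDyer.BirchSwinnertonDyer.Theorems.EtaLayer
  Summit.BirchSwinnertonDyer.BirchSwinnertonDyer.Theorems.UniversalToricDescentRelaxedLayerTransportTorsion

/-! ## §1 `#𝓛_w = #E_L[n]^{D_w}` -/

section Local

variable {L : Type} [Field L] [NumberField L] (W' : WeierstrassCurve L) [W'.IsElliptic]

/-- **`#𝓛_w(E_L[n]) = #{a ∈ E_L[n] | D_w · a = a}`** for `n ≠ 0` a unit at `w` (`D_w = decomp w`, the range of `Γ_{L_w} → Γ_L`).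
[cite: MilneADT2006, I Lemma 3.3] [cite: Greenberg1989, §1 p. 98] -/
theorem natCard_kummerSelmerStructure_inr_eq_natCard_fixed (w : HeightOneSpectrum (𝓞 L)) {n : ℕ} (hn : n ≠ 0)
    (hnw : ((n : ℕ) : 𝓞 L) ∉ w.asIdeal) :
    Nat.card (W'.kummerSelmerStructure (n : ℤ) (Sum.inr w)) =
      Nat.card {a : W'.geomTorsion (n : ℤ) // ∀ g ∈ decomp (K := L) w, g • a = a} := by
  haveI : CharZero (w.adicCompletion L) := charZero_adicCompletion w
  rw [W'.natCard_kummerSelmerStructure_inr w hn]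
  have hu : IsUnit ((n : ℕ) : w.adicCompletionIntegers L) := by
    have h := HeightOneSpectrum.isUnit_algebraMap_adicCompletionIntegers L w hnw
    rw [map_natCast] at h
    exact h
  rw [Summit.BirchSwinnertonDyer.Rank1Residual.X11b.AcSelmer.natCard_quotient_span_singleton_eq_one_of_isUnit hu, mul_one,
    ← Literature.NumberTheory.EllipticCurves.natCard_invariants_torsion_restrictField W' (w.adicCompletion L) hn]
  refine Nat.card_congr (Equiv.subtypeEquivRight fun a ↦ ?_)
  rw [ContRepresentation.mem_invariants]
  constructor
  · intro h g hg
    obtain ⟨σ, rfl⟩ := (mem_decomp_iff w g).mp hg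
    exact h σ
  · intro h σ
    exact h _ ((mem_decomp_iff w _).mpr ⟨σ, rfl⟩)

end Local

/-! ## §2 Through a local package: `#E_L[n]^{D_w} = #E[n]^{U ∩ range(res_ι)}` -/

section Package

variable {K : Type} [Field K] [NumberField K] (W : WeierstrassCurve K) [W.IsElliptic] (n : ℤ)
  (L : Type) [Field L] [NumberField L] [Algebra K L]
  {U : Subgroup (absoluteGaloisGroup K)} (hU : U ≤ galRange (K := K) L) (hH : ∀ τ : absoluteGaloisGroup L, τ ∈ comapResGal L U)

omit [W.IsElliptic] in
include hU hH in
/-- **`#E_L[n]^{D_w} = #E[n]^{U ∩ range(res_ι)}`** for a local package `(ι, ι₂, ι' = closureEmb L_w)` at `w` (`E[n] ≃ E_L[n]` along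
`resGal L`, and `g ∈ D_w ⟺ resGal L g ∈ range(res_ι)`). [cite: SerreGaloisCohomology1997, II.§1.1] [cite: NeukirchANT1999, Ch. II §8] -/
theorem natCard_fixed_baseChange_eq (w : HeightOneSpectrum (𝓞 L)) {E : Type} [Field E] [Algebra K E]
    (ι : AlgebraicClosure K →ₐ[K] AlgebraicClosure E) (ι₂ : AlgebraicClosure E ≃+* AlgebraicClosure (w.adicCompletion L))
    (hcompat : ∀ z : AlgebraicClosure K, closureEmb (K := L) (w.adicCompletion L) (closureEmb (K := K) L z) = ι₂ (ι z))
    (f : E →+* w.adicCompletion L)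
    (hf : ∀ y : E, ι₂ (algebraMap E (AlgebraicClosure E) y) =
      algebraMap (w.adicCompletion L) (AlgebraicClosure (w.adicCompletion L)) (f y))
    (hfix : ∀ h : absoluteGaloisGroup E, resGalOfEmb ι h ∈ galRange (K := K) L → ∀ y : w.adicCompletion L,
      (show AlgebraicClosure E ≃ₐ[E] AlgebraicClosure E from h)
        (ι₂.symm (algebraMap (w.adicCompletion L) (AlgebraicClosure (w.adicCompletion L)) y)) =
      ι₂.symm (algebraMap (w.adicCompletion L) (AlgebraicClosure (w.adicCompletion L)) y)) :
    Nat.card {a : (W.baseChange L).geomTorsion n // ∀ g ∈ decomp (K := L) w, g • a = a} =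
      Nat.card {a : W.geomTorsion n // ∀ g ∈ U ⊓ (resGalOfEmb ι).toMonoidHom.range, g • a = a} := by
  classical
  haveI : PerfectField L := PerfectField.ofCharZero
  set e := torsionBaseChangeEquiv L W n with he
  have hrange : ∀ g : absoluteGaloisGroup L, g ∈ decomp (K := L) w ↔ resGal (K := K) L g ∈ (resGalOfEmb ι).toMonoidHom.range := by
    intro g
    rw [decomp_eq_range]
    exact mem_range_resGalOfEmb_iff_resGal_mem L ι ι₂ (closureEmb (K := L) (w.adicCompletion L)) hcompat f hf hfix g
  refine Nat.card_congr
    { toFun := fun a ↦ ⟨e.symm a.1, fun u hu ↦ ?_⟩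
      invFun := fun b ↦ ⟨e b.1, fun g hg ↦ ?_⟩
      left_inv := fun a ↦ Subtype.ext (e.apply_symm_apply a.1)
      right_inv := fun b ↦ Subtype.ext (e.symm_apply_apply b.1) }
  · -- `u ∈ U ∩ range(res_ι)`: `u = resGal g` with `g ∈ D_w`
    obtain ⟨huU, huι⟩ := Subgroup.mem_inf.mp hu
    have h1 := torsionBaseChangeEquiv_symm_smul L W n ⟨u, hU huU⟩ a.1
    rw [Subgroup.smul_def] at h1
    change u • e.symm a.1 = e.symm a.1
    rw [← h1]
    congr 1
    refine a.2 _ ((hrange _).mpr ?_)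
    rw [resGal_rangeToResGal]
    exact huι
  · -- `g ∈ D_w`: `resGal g ∈ U ∩ range(res_ι)`
    have h1 := torsionBaseChangeEquiv_smul L W n g b.1
    rw [Subgroup.smul_def, coe_resGalToRange] at h1
    rw [← h1]
    congr 1
    exact b.2 _ (Subgroup.mem_inf.mpr ⟨hH g, (hrange g).mp hg⟩)

end Package

/-! ## §3 Conjugate subgroups have equinumerous fixed points -/

section Conj

variable {K : Type} [Field K] (W : WeierstrassCurve K) (n : ℤ)

/-- **`#E[n]^{U ∩ D'} = #E[n]^{U ∩ D}` for `D' = τ⁻¹ D τ`**, `U` normal (`a ↦ τ • a`). [cite: SerreGaloisCohomology1997, I.§2.5] -/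
theorem natCard_fixed_inf_conj_eq (U D D' : Subgroup (absoluteGaloisGroup K)) [U.Normal] (τ : absoluteGaloisGroup K)
    (hDD' : ∀ g, g ∈ D' ↔ τ * g * τ⁻¹ ∈ D) :
    Nat.card {a : W.geomTorsion n // ∀ g ∈ U ⊓ D', g • a = a} = Nat.card {a : W.geomTorsion n // ∀ g ∈ U ⊓ D, g • a = a} := by
  refine Nat.card_congr
    { toFun := fun a ↦ ⟨τ • a.1, fun g hg ↦ ?_⟩
      invFun := fun b ↦ ⟨τ⁻¹ • b.1, fun g hg ↦ ?_⟩
      left_inv := fun a ↦ Subtype.ext (inv_smul_smul τ a.1)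
      right_inv := fun b ↦ Subtype.ext (smul_inv_smul τ b.1) }
  · obtain ⟨hgU, hgD⟩ := Subgroup.mem_inf.mp hg
    have hmem : τ⁻¹ * g * τ ∈ U ⊓ D' := by
      refine Subgroup.mem_inf.mpr ⟨?_, (hDD' _).mpr ?_⟩
      · simpa only [inv_inv] using Subgroup.Normal.conj_mem inferInstance _ hgU τ⁻¹
      · have e : τ * (τ⁻¹ * g * τ) * τ⁻¹ = g := by group
        rw [e]
        exact hgD
    have h := a.2 _ hmem
    calc g • τ • a.1 = τ • ((τ⁻¹ * g * τ) • a.1) := by rw [smul_smul, smul_smul]; congr 1; group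
      _ = τ • a.1 := by rw [h]
  · obtain ⟨hgU, hgD'⟩ := Subgroup.mem_inf.mp hg
    have hmem : τ * g * τ⁻¹ ∈ U ⊓ D := Subgroup.mem_inf.mpr ⟨Subgroup.Normal.conj_mem inferInstance _ hgU τ, (hDD' g).mp hgD'⟩
    have h := b.2 _ hmem
    calc g • τ⁻¹ • b.1 = τ⁻¹ • ((τ * g * τ⁻¹) • b.1) := by rw [smul_smul, smul_smul]; congr 1; group
      _ = τ⁻¹ • b.1 := by rw [h]

end Conj

/-! ## §4 `#𝓛_w(E_L[n]) = #E[n]^{U ∩ D_v}` for every `w ∣ v` -/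

section Main

variable {K : Type} [Field K] [NumberField K] (W : WeierstrassCurve K) [W.IsElliptic] (n : ℕ)
  (L : Type) [Field L] [NumberField L] [Algebra K L]
  {U : Subgroup (absoluteGaloisGroup K)} [U.Normal] (hU : U ≤ galRange (K := K) L)
  (hH : ∀ τ : absoluteGaloisGroup L, τ ∈ comapResGal L U)

include hU hH in
/-- **`#𝓛_w(E_L[n]) = #{a ∈ E[n] | (U ⊓ D_v) · a = a}` for every place `w ∣ v` of the Galois layer `L`** (`n ≠ 0` a unit at `v`).
[cite: MilneADT2006, I Lemma 3.3] [cite: GreenbergLNM1716, §2 (pp. 62–63), §3 (p. 86)] [cite: NeukirchANT1999, Ch. II §8] -/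
theorem natCard_kummerSelmerStructure_inr_eq (hn : n ≠ 0) {v : HeightOneSpectrum (𝓞 K)} (hnv : ((n : ℕ) : 𝓞 K) ∉ v.asIdeal)
    (w : HeightOneSpectrum (𝓞 L)) [hw : w.asIdeal.LiesOver v.asIdeal] :
    Nat.card ((W.baseChange L).kummerSelmerStructure (n : ℤ) (Sum.inr w)) =
      Nat.card {a : W.geomTorsion (n : ℤ) // ∀ g ∈ U ⊓ decomp v, g • a = a} := by
  -- `n` is a unit at `w`
  have hnw : ((n : ℕ) : 𝓞 L) ∉ w.asIdeal := by
    intro h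
    apply hnv
    have h2 : (algebraMap (𝓞 K) (𝓞 L)) (n : 𝓞 K) ∈ w.asIdeal := by rwa [map_natCast]
    rw [← Ideal.mem_comap] at h2
    have h3 : w.asIdeal.comap (algebraMap (𝓞 K) (𝓞 L)) = v.asIdeal := (hw.over).symm
    rwa [h3] at h2
  rw [natCard_kummerSelmerStructure_inr_eq_natCard_fixed (W.baseChange L) w hn hnw]
  -- the package for the `L`-embedding `closureEmb L_w`
  obtain ⟨ι, ι₂, hcompat, hf, hfixL⟩ :=
    exists_package_adicCompletion_of_embedding L v (RingEquiv.refl _) (fun _ ↦ rfl) w (closureEmb (K := L) (w.adicCompletion L))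
  rw [natCard_fixed_baseChange_eq W (n : ℤ) L hU hH w ι ι₂ hcompat
    ((adicCompletionMap (K := K) L v w).comp (RingEquiv.refl (v.adicCompletion K)).symm.toRingHom) hf hfixL]
  obtain ⟨τ, rfl⟩ := exists_algHom_eq_comp (closureEmb (K := K) (v.adicCompletion K)) ι
  rw [natCard_fixed_inf_conj_eq W (n : ℤ) U (decomp v) _ (show absoluteGaloisGroup K from τ)
    (mem_range_resGalOfEmb_comp_iff (closureEmb (K := K) (v.adicCompletion K)) τ)]

end Main

end Summit.BirchSwinnertonDyer.BirchSwinnertonDyer.Theorems.UniversalToricDescentRelaxedLocalCount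

end
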